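import Summits.Ventures.LatticeQCDFlow.Exactness.IMHMultiProposalExact
import HarnessLib

/-!
# The multi-proposal flow sampler needs no normaliser: pool selection with the UNNORMALISED weight `w̃ = Z·w` is the same kernel, hence exact for `π = w·q`

HONEST FRAMING: exact (Metropolis-corrected) sampling algorithms for lattice gauge theory;
figures of merit are autocorrelation/cost numbers at stated couplings and volumes; no
continuum-physics claim.

Venture `LatticeQCDFlow` (cell pub-lqcd), topic `Exactness`; FANOUT row 30 (lean-1, GEN-41).  NEW WORK of the cell, a short sequel of GEN-41's
`IMHMultiProposalExact`, whose def-free kernel equation is written with the NORMALISED weight `w = dπ/dq` (and whose gauge instances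
`Scaling/AutoregressiveGauge{AllClosing,HeatBath}MultiProposal` therefore display the normaliser `Z`).  In practice the sampler evaluates the
unnormalised weight `w̃ = e^{−S}/q̃ = Z·w` with `Z` unknown.  Pool selection is scale invariant, so nothing is lost:

* `poolSelect_integrand_smul` — for `c > 0`, `Σ_j (c·w)(z_j)1_B(z_j) / Σ_i (c·w)(z_i) = Σ_j w(z_j)1_B(z_j) / Σ_i w(z_i)` (`ℝ≥0∞`, pointwise in the pool);
* **`multiProposal_kernelEq_of_smul`** — a kernel satisfying the pool-selection equation with the weight `c·w` satisfies it with `w`;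
* **`multiProposal_invariant_unnormalised`**, **`multiProposal_detailedBalance_unnormalised`** — hence the sampler run with ANY positive multiple of
  the weight (in particular the unnormalised `w̃`) is in detailed balance with, and leaves invariant, `π = w·q`.
Reading (gauge files): the ensemble gauge samplers may be run with `e^{−S}/q̃` in place of the displayed normalised weight; exactness and the rates of
`IMHMultiProposalMinorisation` are unchanged (the rate's `W` is the bound of the NORMALISED weight).  No `sorry`, no new definitions, nothing cited as a fact.
-/

noncomputable section

namespace Summit.Ventures.LatticeQCDFlow.Exactness

open MeasureTheory ProbabilityTheory Function Finset
open scoped ENNReal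

variable {Ω : Type*} [MeasurableSpace Ω] {q : Measure Ω} [IsProbabilityMeasure q] {w : Ω → ℝ} {n : ℕ}

omit [MeasurableSpace Ω] in
/-- **Pool selection is scale invariant**: multiplying the weight by `c > 0` does not change the selection probabilities. [ours] -/
theorem poolSelect_integrand_smul (w : Ω → ℝ) {c : ℝ} (hc : 0 < c) (B : Set Ω) (z : Fin (n + 1) → Ω) :
    (∑ j, ENNReal.ofReal (c * w (z j)) * B.indicator (fun _ => (1 : ℝ≥0∞)) (z j)) / (∑ i, ENNReal.ofReal (c * w (z i))) =
      (∑ j, ENNReal.ofReal (w (z j)) * B.indicator (fun _ => (1 : ℝ≥0∞)) (z j)) / ∑ i, ENNReal.ofReal (w (z i)) := by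
  have hcw : ∀ y, ENNReal.ofReal (c * w y) = ENNReal.ofReal c * ENNReal.ofReal (w y) := fun y => ENNReal.ofReal_mul hc.le
  simp_rw [hcw, mul_assoc, ← Finset.mul_sum]
  exact ENNReal.mul_div_mul_left _ _ (ne_of_gt (ENNReal.ofReal_pos.2 hc)) ENNReal.ofReal_ne_top

omit [IsProbabilityMeasure q] in
/-- **A kernel satisfying the pool-selection equation with the weight `c·w` (`c > 0`) satisfies it with `w`.** [ours] -/
theorem multiProposal_kernelEq_of_smul {c : ℝ} (hc : 0 < c) (P : Kernel Ω Ω)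
    (hP : ∀ (x : Ω) {B : Set Ω}, MeasurableSet B → P x B = ∫⁻ y, (∑ j, ENNReal.ofReal (c * w (Fin.cons (α := fun _ : Fin (n + 1) => Ω) x y j)) *
      B.indicator (fun _ => (1 : ℝ≥0∞)) (Fin.cons (α := fun _ : Fin (n + 1) => Ω) x y j)) /
      (∑ i, ENNReal.ofReal (c * w (Fin.cons (α := fun _ : Fin (n + 1) => Ω) x y i))) ∂(Measure.pi fun _ : Fin n => q)) :
    ∀ (x : Ω) {B : Set Ω}, MeasurableSet B → P x B = ∫⁻ y, (∑ j, ENNReal.ofReal (w (Fin.cons (α := fun _ : Fin (n + 1) => Ω) x y j)) *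
      B.indicator (fun _ => (1 : ℝ≥0∞)) (Fin.cons (α := fun _ : Fin (n + 1) => Ω) x y j)) /
      (∑ i, ENNReal.ofReal (w (Fin.cons (α := fun _ : Fin (n + 1) => Ω) x y i))) ∂(Measure.pi fun _ : Fin n => q) := by
  intro x B hB
  rw [hP x hB]
  exact lintegral_congr fun y => poolSelect_integrand_smul w hc B _

/-- **THE SAMPLER RUN WITH ANY POSITIVE MULTIPLE OF THE WEIGHT LEAVES `π = w·q` INVARIANT** (in particular with the unnormalised `w̃ = Z·w`). [ours] -/
theorem multiProposal_invariant_unnormalised (hw : Measurable w) (hw0 : ∀ y, 0 < w y) {c : ℝ} (hc : 0 < c) (P : Kernel Ω Ω)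
    (hP : ∀ (x : Ω) {B : Set Ω}, MeasurableSet B → P x B = ∫⁻ y, (∑ j, ENNReal.ofReal (c * w (Fin.cons (α := fun _ : Fin (n + 1) => Ω) x y j)) *
      B.indicator (fun _ => (1 : ℝ≥0∞)) (Fin.cons (α := fun _ : Fin (n + 1) => Ω) x y j)) /
      (∑ i, ENNReal.ofReal (c * w (Fin.cons (α := fun _ : Fin (n + 1) => Ω) x y i))) ∂(Measure.pi fun _ : Fin n => q))
    {B : Set Ω} (hB : MeasurableSet B) :
    ∫⁻ x, P x B ∂(q.withDensity fun x => ENNReal.ofReal (w x)) = (q.withDensity fun x => ENNReal.ofReal (w x)) B :=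
  multiProposal_invariant hw hw0 P (multiProposal_kernelEq_of_smul hc P hP) hB

/-- **… AND IS IN DETAILED BALANCE WITH `π`.** [ours] -/
theorem multiProposal_detailedBalance_unnormalised (hw : Measurable w) {c : ℝ} (hc : 0 < c) (P : Kernel Ω Ω)
    (hP : ∀ (x : Ω) {B : Set Ω}, MeasurableSet B → P x B = ∫⁻ y, (∑ j, ENNReal.ofReal (c * w (Fin.cons (α := fun _ : Fin (n + 1) => Ω) x y j)) *
      B.indicator (fun _ => (1 : ℝ≥0∞)) (Fin.cons (α := fun _ : Fin (n + 1) => Ω) x y j)) /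
      (∑ i, ENNReal.ofReal (c * w (Fin.cons (α := fun _ : Fin (n + 1) => Ω) x y i))) ∂(Measure.pi fun _ : Fin n => q))
    {A B : Set Ω} (hA : MeasurableSet A) (hB : MeasurableSet B) :
    ∫⁻ x in A, P x B ∂(q.withDensity fun x => ENNReal.ofReal (w x)) = ∫⁻ x in B, P x A ∂(q.withDensity fun x => ENNReal.ofReal (w x)) :=
  multiProposal_detailedBalance hw P (multiProposal_kernelEq_of_smul hc P hP) hA hB

end Summit.Ventures.LatticeQCDFlow.Exactness
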